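import Literature.AlgebraicGeometry.Motives.AlgPointsProperProofs
import Literature.NumberTheory.Transcendental.AnalytificationFunctorialityProofs
import Mathlib.Topology.Maps.Proper.Basic
import HarnessLib

/-!
# `f(L) : X(L) → S(L)` is a proper map for `f : X → S` proper (proof file)

Sibling of `Literature/AlgebraicGeometry/Motives/AlgPointsProperProofs.lean`, which proves the
ABSOLUTE statement (`compactSpace_algPoints_of_isProper_holds`: `X(L)` is compact for `X` proper
over `k` and `L ⊇ k` a locally compact non-trivially normed field) by the valuative argument run
with an ultrapower `L^𝒰`. This file proves the RELATIVE statement by the same argument: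

* `AlgPoints.exists_le_nhds_of_tendsto_map` — for `f : X ⟶ S` with `f` universally closed, an
  ultrafilter `𝒰` on `X(L)` whose image `f(𝒰)` converges to `t ∈ S(L)` converges to a point `P₀`
  with `f(P₀) = t`, granted an affine open `U ⊆ f⁻¹V` (`V ∋ t` affine) with `U(L) ∈ 𝒰`;
* `AlgPoints.isProperMap_map` — **`f(L) : X(L) → S(L)` is a proper map of topological spaces**
  (universally closed for the strong topologies: closed with compact fibres, preimages of compact
  sets compact) for `f` universally closed and quasi-compact, in particular for `f` proper — the
  topological half of «`f` propre ⇔ `f^an` propre» (SGA 1, Exp. XII, Prop. 3.2 (v); for `L = ℂ`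
  and complete varieties Serre, GAGA §2 n°7 Prop. 6, Mumford, *Red Book* I §10 Thm. 2; for local
  fields B. Conrad, *Weil and Grothendieck approaches to adelic points*, Prop. 4.4 and §5);
* consequences used by families `f : 𝒳 → S` over their complex points: `isClosedMap_map`,
  `isCompact_preimage_map` and the **tube lemma** `exists_isOpen_preimage_map_subset`: every
  neighbourhood of a fibre `f⁻¹{t}(L)` contains a whole tube `f⁻¹V(L)`, `V ∋ t` open.

## Proof

As in the absolute case (see that file's docstring) with the valuative square now over `S`:
`K := L^𝒰`, `R ⊆ K` the valuation ring of bounded germs, `st : R → L` the standard part. The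
tautological point `Q : Spec K → U ⊆ X` is `a ↦` germ of `P ↦ a(P)`; on the base, the ring map
`Γ(S, V) → K`, `b ↦` germ of `P ↦ b(f(P))`, takes values in `R` BECAUSE `f(𝒰) → t`
(`b(f(P)) → b(t)` along `𝒰`, `AlgPoints.tendsto_nhds_iff_of_mem_affineOpen`), giving
`Spec R → V ⊆ S`; the square commutes since `b(f(P)) = (f^* b)(P)` (`AlgPoints.eval_map`). The
valuative criterion for the universally closed `f` (Mathlib
`UniversallyClosed.eq_valuativeCriterion`) yields `l : Spec R → X`; `Spec R` lands in an affine
open `V' ⊆ f⁻¹V`, `l` is a ring map `β : Γ(X, V') → R`, `P₀ := st ∘ β ∈ V'(L)`, and `𝒰 → P₀`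
exactly as in the absolute case. Finally `f(P₀) = t` because both lie in `V(L)` and for
`b ∈ Γ(S, V)`, `b(f(P₀)) = st(β(f^* b)) = lim_𝒰 b(f(P)) = b(t)` (points of an affine open are
determined by the values of its regular functions, `AlgPoints.ext_of_forall_eval_eq`).

## References

* A. Grothendieck, M. Raynaud, SGA 1, Exp. XII, Prop. 3.2 (v) (via EGA II (7.3.8)). [SGA1]
* J.-P. Serre, *Géométrie algébrique et géométrie analytique*, Ann. Inst. Fourier 6 (1956), §2
  n°7 Prop. 6. [SerreGAGA1956]
* D. Mumford, *The Red Book of Varieties and Schemes*, I §10 Thm. 2. [MumfordRedBook1999]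
* B. Conrad, *Weil and Grothendieck approaches to adelic points*, Enseign. Math. 58 (2012),
  Prop. 2.1, Prop. 4.4, §5. [ConradAdelicPoints2012]
-/

noncomputable section

universe u

open CategoryTheory AlgebraicGeometry Topology TopologicalSpace Filter

namespace Literature.AlgebraicGeometry.Motives

variable {k : Type u} [Field k]

namespace AlgPoints

/-! ### The preimage of a base open on points -/

section Preimage

variable {X S : SchemeOver k} {L : Type u} [Field L] [Algebra k L]

/-- `f(P) ∈ V(L) ↔ P ∈ (f⁻¹V)(L)` (the underlying point of `f(P)` is `f(P.pt)`). [folklore] -/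
theorem pt_map_mem_iff (f : X ⟶ S) (P : AlgPoints X L) (V : S.left.Opens) :
    (map f P).pt ∈ V ↔ P.pt ∈ f.left ⁻¹ᵁ V :=
  Iff.rfl

/-- **`(f^* b)(P) = b(f(P))`** for `b ∈ Γ(S, V)` and `P ∈ U(L)` with `U ⊆ f⁻¹V`, in terms of
`Scheme.Hom.appLE` (`AlgPoints.eval_map` and compatibility of evaluation with restriction).
[Hartshorne II Ex. 2.7] [folklore] -/
theorem eval_appLE_eq_eval_map (f : X ⟶ S) {V : S.left.Opens} {U : X.left.Opens}
    (hUV : U ≤ f.left ⁻¹ᵁ V) (P : AlgPoints X L) (hP : P.pt ∈ U) (b : Γ(S.left, V)) :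
    P.eval U hP (f.left.appLE V U hUV b) = (map f P).eval V (hUV hP) b := by
  rw [eval_map]
  exact eval_map_homOfLE hUV (f.left.app V b) hP

end Preimage

/-! ### Relative version of the valuative argument -/

section Main

variable {X S : SchemeOver k} {L : Type u} [NontriviallyNormedField L] [Algebra k L]
  [LocallyCompactSpace L]

open Ultra in
/-- **An ultrafilter on `X(L)` whose image converges in `S(L)` converges, for `f : X → S`
universally closed** (`L ⊇ k` a locally compact non-trivially normed field). Precisely: if
`f(𝒰) → t`, `V ∋ t` is an affine open of `S` and `U ⊆ f⁻¹V` an affine open of `X` with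
`U(L) ∈ 𝒰`, then `𝒰 → P₀` for some `P₀ ∈ X(L)` with `f(P₀) = t`. The valuative proof of
SGA 1 XII Prop. 3.2 (v) / EGA II (7.3.8), run with the ultrapower `L^𝒰` and its valuation ring of
bounded germs as in `AlgPoints.exists_ultrafilter_le_nhds` (the case `S = Spec k`); the base map
`Spec R → S` exists because `b(f(P)) → b(t)` is bounded for every `b ∈ Γ(S, V)`.
[cite: ConradAdelicPoints2012, Prop. 2.1, Prop. 4.4 and §5] [cite: SGA1, Exp. XII Prop. 3.2 (v)] -/
theorem exists_le_nhds_of_tendsto_map (f : X ⟶ S) [UniversallyClosed f.left]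
    (𝒰 : Ultrafilter (AlgPoints X L)) {t : AlgPoints S L}
    (ht : Tendsto (map f) (𝒰 : Filter (AlgPoints X L)) (𝓝 t))
    {V : S.left.Opens} (hV : IsAffineOpen V) (htV : t.pt ∈ V)
    {U : X.left.Opens} (hU : IsAffineOpen U) (hUV : U ≤ f.left ⁻¹ᵁ V)
    (hU𝒰 : {P : AlgPoints X L | P.pt ∈ U} ∈ (𝒰 : Filter (AlgPoints X L))) :
    ∃ P₀ : AlgPoints X L, map f P₀ = t ∧ (𝒰 : Filter (AlgPoints X L)) ≤ 𝓝 P₀ := by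
  -- the ultrapower field `K = L^𝒰`, its valuation ring `R` of bounded germs
  let K : Type u := Germ (𝒰 : Filter (AlgPoints X L)) L
  let R : ValuationSubring K := boundedSubring 𝒰 L
  letI : Algebra k R := ((constRingHom 𝒰 L).comp (algebraMap k L)).toAlgebra
  letI : Algebra k K := ((algebraMap R K).comp (algebraMap k R)).toAlgebra
  have halgK : ∀ c : k, algebraMap k K c =
      ((fun _ ↦ algebraMap k L c : AlgPoints X L → L) : K) := fun c ↦ rfl
  have halgRK : (algebraMap R K).comp (algebraMap k R) = algebraMap k K := rfl
  -- the tautological `K`-point `Q` of `U`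
  let τ : Γ(X.left, U) →+* K := germRingHom 𝒰 hU𝒰
  have hτ : ∀ a, τ a = ((evalOrZero U a : AlgPoints X L → L) : K) := fun a ↦ rfl
  have hτk : τ.comp (SchemeOver.scalarRingHom X U) = algebraMap k K :=
    RingHom.ext fun c ↦ (germRingHom_scalarRingHom 𝒰 hU𝒰 c).trans (halgK c).symm
  let Q : AlgPoints X K := ofRingHom hU τ hτk
  have hQU : Q.pt ∈ U := pt_ofRingHom_mem hU τ hτk
  have hQeval : ∀ a, Q.eval U hQU a = τ a := eval_ofRingHom hU τ hτk hQU
  -- convergence of `f(𝒰)` to `t`, tested on the regular functions `b ∈ Γ(S, V)`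
  have hconv : ∀ b : Γ(S.left, V),
      Tendsto (fun P ↦ evalOrZero V b (map f P)) (𝒰 : Filter (AlgPoints X L))
        (𝓝 (t.eval V htV b)) :=
    ((tendsto_nhds_iff_of_mem_affineOpen hV htV).mp ht).2
  -- the base ring map `Γ(S, V) → K`, `b ↦` germ of `P ↦ b(f(P))`, lands in `R`
  have hfV𝒰 : {P : AlgPoints X L | P.pt ∈ f.left ⁻¹ᵁ V} ∈ (𝒰 : Filter (AlgPoints X L)) :=
    mem_of_superset hU𝒰 fun P hP ↦ hUV hP
  let σ₀ : Γ(S.left, V) →+* K := (germRingHom 𝒰 hfV𝒰).comp (f.left.app V).hom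
  have hσ₀ : ∀ b, σ₀ b = ((fun P ↦ evalOrZero V b (map f P) : AlgPoints X L → L) : K) := by
    intro b
    change germRingHom 𝒰 hfV𝒰 (f.left.app V b) = _
    rw [germRingHom_apply]
    exact congrArg (fun g : AlgPoints X L → L ↦ (g : K)) (funext fun P ↦ (evalOrZero_map f V b P).symm)
  have hσ₀R : ∀ b, σ₀ b ∈ R := by
    intro b
    rw [hσ₀]
    refine (coe_mem_boundedSubring_iff 𝒰 L _).mpr ⟨‖t.eval V htV b‖ + 1, ?_⟩
    filter_upwards [(hconv b).norm.eventually (gt_mem_nhds (lt_add_one _))] with P hP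
    exact le_of_lt hP
  let σ : Γ(S.left, V) →+* R := σ₀.codRestrict R hσ₀R
  have hσ : ∀ b, ((σ b : R) : K) = σ₀ b := fun b ↦ rfl
  -- `Spec R → V ⊆ S`
  let i₂ : Spec (.of R) ⟶ S.left := Spec.map (CommRingCat.ofHom σ) ≫ hV.fromSpec
  -- valuative criterion: `Q` extends to `l : Spec R → X` over `S`
  have hE : ValuativeCriterion.Existence f.left := by
    have h : UniversallyClosed f.left := inferInstance
    rw [UniversallyClosed.eq_valuativeCriterion] at h
    exact h.1
  -- the square commutes: `b(f(P)) = (f^* b)(P)` for `P ∈ U(L)`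
  have hsq : Q.toSpecHom ≫ f.left = Spec.map (CommRingCat.ofHom (algebraMap R K)) ≫ i₂ := by
    have h1 := IsAffineOpen.SpecMap_appLE_fromSpec f.left hV hU hUV
    change (Spec.map (CommRingCat.ofHom τ) ≫ hU.fromSpec) ≫ f.left =
      Spec.map (CommRingCat.ofHom (algebraMap R K)) ≫ Spec.map (CommRingCat.ofHom σ) ≫ hV.fromSpec
    rw [Category.assoc, ← h1, ← Spec.map_comp_assoc, ← Spec.map_comp_assoc]
    congr 2
    ext b : 2
    change τ (f.left.appLE V U hUV b) = ((σ b : R) : K)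
    rw [hσ, hσ₀, hτ]
    refine Germ.coe_eq.mpr ?_
    filter_upwards [hU𝒰] with P hP
    rw [evalOrZero_of_mem _ hP, eval_appLE_eq_eval_map f hUV P hP b,
      evalOrZero_of_mem b (show (map f P).pt ∈ V from hUV hP)]
  let sq : ValuativeCommSq f.left :=
    { R := R
      K := K
      i₁ := Q.toSpecHom
      i₂ := i₂
      commSq := ⟨hsq⟩ }
  obtain ⟨⟨l, hl₁, hl₂⟩⟩ := (hE sq).exists_lift
  change Spec.map (CommRingCat.ofHom (algebraMap R K)) ≫ l = Q.toSpecHom at hl₁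
  change l ≫ f.left = i₂ at hl₂
  -- all of `Spec R` maps into an affine open `V' ∋ l (closed point)` with `V' ⊆ f⁻¹ V`
  have hx₀ : l (IsLocalRing.closedPoint R) ∈ ((f.left ⁻¹ᵁ V : X.left.Opens) : Set X.left) := by
    change (l ≫ f.left) (IsLocalRing.closedPoint R) ∈ (V : Set S.left)
    rw [hl₂]
    change hV.fromSpec (Spec.map (CommRingCat.ofHom σ) (IsLocalRing.closedPoint R)) ∈ (V : Set S.left)
    have : hV.fromSpec (Spec.map (CommRingCat.ofHom σ) (IsLocalRing.closedPoint R)) ∈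
        Set.range hV.fromSpec := Set.mem_range_self _
    rwa [hV.range_fromSpec] at this
  obtain ⟨_, ⟨V', hV', rfl⟩, hx₀V', hV'V⟩ :=
    X.left.isBasis_affineOpens.exists_subset_of_mem_open hx₀ (f.left ⁻¹ᵁ V).isOpen
  have hV'le : V' ≤ f.left ⁻¹ᵁ V := hV'V
  have hlV' : l ⁻¹ᵁ V' = ⊤ := Scheme.preimage_eq_top_of_closedPoint_mem l hx₀V'
  have hlV'' : ∀ z, l.base z ∈ V' := fun z ↦ by
    have hz : z ∈ l ⁻¹ᵁ V' := by rw [hlV']; trivial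
    exact hz
  -- `l` is a ring map `β : Γ(X, V') → R`, compatible with the scalars
  let β : Γ(X.left, V') →+* R := (l.appLE V' ⊤ hlV'.ge ≫ (Scheme.ΓSpecIso (.of R)).hom).hom
  have hβ : ∀ a, β a = (Scheme.ΓSpecIso (.of R)).hom (l.appLE V' ⊤ hlV'.ge a) := fun a ↦ rfl
  -- `β ∘ f^* = σ` on `Γ(S, V)`
  have hβσ : ∀ b : Γ(S.left, V), β (f.left.appLE V V' hV'le b) = σ b := by
    intro b
    rw [hβ]
    have h1 := ConcreteCategory.congr_hom
      (Scheme.Hom.appLE_comp_appLE l f.left V V' ⊤ hV'le hlV'.ge) b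
    rw [CommRingCat.comp_apply] at h1
    rw [h1]
    have key : ∀ (g : Spec (.of R) ⟶ S.left), g = i₂ → ∀ e,
        (Scheme.ΓSpecIso (.of R)).hom (g.appLE V ⊤ e b) = σ b := by
      rintro _ rfl e
      change (Scheme.ΓSpecIso (.of R)).hom
        ((Spec.map (CommRingCat.ofHom σ) ≫ hV.fromSpec).appLE V ⊤ e b) = σ b
      rw [Scheme.Hom.comp_appLE, hV.fromSpec_app_self]
      simp only [Category.assoc, Scheme.Hom.map_appLE]
      rw [CommRingCat.comp_apply, ΓSpecIso_hom_SpecMap_appLE_top]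
      exact congrArg σ (Iso.inv_hom_id_apply _ b)
    exact key _ hl₂ _
  have hβk : β.comp (SchemeOver.scalarRingHom X V') = algebraMap k R := by
    refine RingHom.ext fun c ↦ ?_
    rw [RingHom.comp_apply, SchemeOver.scalarRingHom_apply]
    -- `X.hom = f.left ≫ S.hom`, so the scalar `c` on `V'` is `f^*` of the scalar `c` on `V`
    have hXhom : X.hom.appLE ⊤ V' le_top ((Scheme.ΓSpecIso (.of k)).inv c) =
        f.left.appLE V V' hV'le (SchemeOver.scalarRingHom S V c) := by
      rw [SchemeOver.scalarRingHom_apply]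
      have h2 := ConcreteCategory.congr_hom
        (Scheme.Hom.appLE_comp_appLE f.left S.hom ⊤ V V' le_top hV'le) ((Scheme.ΓSpecIso (.of k)).inv c)
      rw [CommRingCat.comp_apply] at h2
      rw [h2]
      have key : ∀ (g : X.left ⟶ Spec (.of k)), g = X.hom → ∀ e s,
          X.hom.appLE ⊤ V' le_top s = g.appLE ⊤ V' e s := by
        rintro _ rfl e s
        rfl
      exact key _ (Over.w f) _ _
    rw [hXhom, hβσ]
    apply Subtype.ext
    rw [hσ, hσ₀]
    change _ = (((fun _ ↦ algebraMap k L c : AlgPoints X L → L) : K))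
    refine Germ.coe_eq.mpr ?_
    filter_upwards [hfV𝒰] with P hP
    rw [evalOrZero_of_mem _ (show (map f P).pt ∈ V from hP), eval_scalarRingHom]
  -- the limit point: the `L`-point `st ∘ β` of `V'`
  have hP₀k : ((st 𝒰 L).comp β).comp (SchemeOver.scalarRingHom X V') = algebraMap k L := by
    rw [RingHom.comp_assoc, hβk]
    exact RingHom.ext fun c ↦ st_constRingHom 𝒰 L (algebraMap k L c)
  let P₀ : AlgPoints X L := ofRingHom hV' ((st 𝒰 L).comp β) hP₀k
  have hP₀V' : P₀.pt ∈ V' := pt_ofRingHom_mem hV' _ hP₀k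
  have hP₀eval : ∀ a, P₀.eval V' hP₀V' a = st 𝒰 L (β a) := fun a ↦
    eval_ofRingHom hV' _ hP₀k hP₀V' a
  refine ⟨P₀, ?_, ?_⟩
  · -- `f(P₀) = t`: both lie in `V(L)` and all `b ∈ Γ(S, V)` take the same value
    refine ext_of_forall_eval_eq hV (hV'le hP₀V') htV fun b ↦ ?_
    rw [← eval_appLE_eq_eval_map f hV'le P₀ hP₀V' b, hP₀eval, hβσ]
    refine tendsto_nhds_unique (tendsto_st 𝒰 L (σ b) ?_) (hconv b)
    rw [hσ, hσ₀]
  -- `Q` factors through `l`: `Q` lands in `V'` and `Q^*(a) = β a` in `K` for `a ∈ Γ(X, V')`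
  have hQl : Q.toSpecHom = Spec.map (CommRingCat.ofHom (algebraMap R K)) ≫ l := hl₁.symm
  have hQV' : Q.pt ∈ V' := by
    have hpt : Q.pt = l.base ((Spec.map (CommRingCat.ofHom (algebraMap R K))).base
        (IsLocalRing.closedPoint K)) := by
      change Q.toSpecHom.base (IsLocalRing.closedPoint K) = _
      rw [hQl]
      rfl
    rw [hpt]
    exact hlV'' _
  have hβK : ∀ a : Γ(X.left, V'), ((β a : R) : K) = Q.eval V' hQV' a := by
    intro a
    have e' : (⊤ : (Spec (.of K)).Opens) ≤
        (Spec.map (CommRingCat.ofHom (algebraMap R K)) ≫ l) ⁻¹ᵁ V' := by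
      rw [← hQl]
      exact (Q.preimage_eq_top hQV').ge
    rw [eval_eq_ΓSpecIso_appLE Q V' hQV' a _ hQl e']
    have h2 : (Spec.map (CommRingCat.ofHom (algebraMap R K))).appLE ⊤ ⊤ le_top
        (l.appLE V' ⊤ hlV'.ge a) =
        (Spec.map (CommRingCat.ofHom (algebraMap R K)) ≫ l).appLE V' ⊤ e' a := by
      have := ConcreteCategory.congr_hom (Scheme.Hom.appLE_comp_appLE
        (Spec.map (CommRingCat.ofHom (algebraMap R K))) l V' ⊤ ⊤ hlV'.ge le_top) a
      rwa [CommRingCat.comp_apply] at this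
    rw [← h2, ΓSpecIso_hom_SpecMap_appLE_top]
    rfl
  -- a basic open `D(g) ⊆ U ∩ V'` through `Q`
  obtain ⟨g, hgle, hQg⟩ :=
    hU.exists_basicOpen_le (V := U ⊓ V') ⟨Q.pt, Opens.mem_inf.mpr ⟨hQU, hQV'⟩⟩ hQU
  have hgU : X.left.basicOpen g ≤ U := X.left.basicOpen_le g
  have hgV' : X.left.basicOpen g ≤ V' := hgle.trans inf_le_right
  -- `g ≠ 0` in `K`: `𝒰`-almost all `P` lie in `D(g) ⊆ V'`
  have hg𝒰 : ∀ᶠ P in (𝒰 : Filter (AlgPoints X L)), P.pt ∈ X.left.basicOpen g := by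
    have hgK : τ g ≠ 0 := by
      rw [← hQeval]
      exact (Q.pt_mem_basicOpen_iff hQU g).mp hQg
    have hne : ¬ ∀ᶠ P in (𝒰 : Filter (AlgPoints X L)), evalOrZero U g P = 0 := fun h ↦
      hgK (by rw [hτ, ← Germ.coe_zero]; exact Germ.coe_eq.mpr h)
    filter_upwards [Ultrafilter.eventually_not.mpr hne, hU𝒰] with P hP hPU
    rw [evalOrZero_of_mem g hPU] at hP
    exact (P.pt_mem_basicOpen_iff hPU g).mpr hP
  -- convergence to `P₀ ∈ V'(L)` is tested on the regular functions on `V'`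
  change Tendsto id (𝒰 : Filter (AlgPoints X L)) (𝓝 P₀)
  rw [tendsto_nhds_iff_of_mem_affineOpen hV' hP₀V']
  refine ⟨hg𝒰.mono fun P hP ↦ hgV' hP, fun a ↦ ?_⟩
  -- `a = a' / g ^ m` on `D(g)`, for `L`-points and for the `K`-point `Q`
  obtain ⟨a', m, hfa⟩ := exists_map_mul_pow_eq_algebraMap hU g a hgV'
  have hL := eval_eq_div_of_map_mul_pow_eq (L := L) g a' a hgV' m hfa
  have hK := eval_eq_div_of_map_mul_pow_eq (L := K) g a' a hgV' m hfa Q hQg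
  -- hence the germ of `P ↦ a(P)` is `β a`, whose standard part is `a(P₀)`
  have hgerm : ((evalOrZero V' a : AlgPoints X L → L) : K) = ((β a : R) : K) := by
    rw [hβK, hK, hQeval, hQeval, hτ, hτ, ← Germ.coe_pow, ← Germ.coe_div]
    refine Germ.coe_eq.mpr ?_
    filter_upwards [hg𝒰] with P hP
    rw [Pi.div_apply, Pi.pow_apply, evalOrZero_of_mem a (hgV' hP), hL P hP,
      evalOrZero_of_mem a' (hgU hP), evalOrZero_of_mem g (hgU hP)]
  rw [hP₀eval]
  exact tendsto_st 𝒰 L (β a) hgerm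

omit [LocallyCompactSpace L] in
/-- Some affine chart inside `f⁻¹V` is `𝒰`-large when `(f⁻¹V)(L) ∈ 𝒰` and `f` is quasi-compact
(`f⁻¹V` is covered by finitely many affine opens). [folklore] -/
theorem exists_isAffineOpen_le_preimage_mem (f : X ⟶ S) [QuasiCompact f.left]
    (𝒰 : Ultrafilter (AlgPoints X L)) {V : S.left.Opens} (hV : IsAffineOpen V)
    (hV𝒰 : {P : AlgPoints X L | P.pt ∈ f.left ⁻¹ᵁ V} ∈ (𝒰 : Filter (AlgPoints X L))) :
    ∃ U : X.left.Opens, IsAffineOpen U ∧ U ≤ f.left ⁻¹ᵁ V ∧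
      {P : AlgPoints X L | P.pt ∈ U} ∈ (𝒰 : Filter (AlgPoints X L)) := by
  have hc : IsCompact ((f.left ⁻¹ᵁ V : X.left.Opens) : Set X.left) :=
    QuasiCompact.isCompact_preimage (f := f.left) _ V.isOpen hV.isCompact
  -- affine opens inside `f⁻¹ V` cover it; extract a finite subcover
  let ι := {U : X.left.affineOpens // (U : X.left.Opens) ≤ f.left ⁻¹ᵁ V}
  obtain ⟨s, hs⟩ := hc.elim_finite_subcover (fun U : ι ↦ ((U.1 : X.left.Opens) : Set X.left))
    (fun U ↦ U.1.1.isOpen) (fun x hx ↦ by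
      obtain ⟨_, ⟨U, hU, rfl⟩, hxU, hUV⟩ :=
        X.left.isBasis_affineOpens.exists_subset_of_mem_open hx (f.left ⁻¹ᵁ V).isOpen
      exact Set.mem_iUnion.mpr ⟨⟨⟨U, hU⟩, hUV⟩, hxU⟩)
  have hcov : {P : AlgPoints X L | P.pt ∈ f.left ⁻¹ᵁ V} ⊆
      ⋃ U ∈ (s : Set ι), {P : AlgPoints X L | P.pt ∈ (U.1 : X.left.Opens)} := by
    intro P hP
    have hP' := hs hP
    simp only [Set.mem_iUnion] at hP'
    obtain ⟨U, hUs, hPU⟩ := hP'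
    exact Set.mem_biUnion (Finset.mem_coe.mpr hUs) hPU
  obtain ⟨U, -, hU⟩ :=
    (Ultrafilter.finite_biUnion_mem_iff s.finite_toSet).mp (mem_of_superset hV𝒰 hcov)
  exact ⟨U.1, U.1.2, U.2, hU⟩

/-- **`f(L) : X(L) → S(L)` is a proper map for `f` universally closed and quasi-compact** — in
particular for `f` proper — and `L ⊇ k` a locally compact non-trivially normed field (`ℝ`, `ℂ`,
local fields): every ultrafilter on `X(L)` whose image converges to `t` converges to a point over
`t` (`exists_le_nhds_of_tendsto_map`, applied on an affine chart `U ⊆ f⁻¹V`, `V ∋ t` affine,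
with `U(L)` in the ultrafilter, `exists_isAffineOpen_le_preimage_mem`). The topological content of
«`f` propre ⇒ `f^an` propre». [cite: SGA1, Exp. XII Prop. 3.2 (v)]
[cite: ConradAdelicPoints2012, Prop. 4.4 and §5] [cite: MumfordRedBook1999, I.10 Thm. 2] -/
theorem isProperMap_map (f : X ⟶ S) [UniversallyClosed f.left] [QuasiCompact f.left] :
    IsProperMap (map f : AlgPoints X L → AlgPoints S L) := by
  rw [isProperMap_iff_ultrafilter]
  refine ⟨continuous_map f, fun 𝒰 t ht ↦ ?_⟩
  obtain ⟨_, ⟨V, hV, rfl⟩, htV, -⟩ :=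
    S.left.isBasis_affineOpens.exists_subset_of_mem_open (Set.mem_univ t.pt) isOpen_univ
  have hVt : {R : AlgPoints S L | R.pt ∈ V} ∈ 𝓝 t := (isOpen_setOf_pt_mem V).mem_nhds htV
  have hV𝒰 : {P : AlgPoints X L | P.pt ∈ f.left ⁻¹ᵁ V} ∈ (𝒰 : Filter (AlgPoints X L)) := ht hVt
  obtain ⟨U, hU, hUV, hU𝒰⟩ := exists_isAffineOpen_le_preimage_mem f 𝒰 hV hV𝒰
  obtain ⟨P₀, hP₀, hle⟩ := exists_le_nhds_of_tendsto_map f 𝒰 ht hV htV hU hUV hU𝒰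
  exact ⟨P₀, hP₀, hle⟩

/-- `f(L)` is a closed map for `f` universally closed and quasi-compact (e.g. proper).
[cite: SGA1, Exp. XII Prop. 3.2 (v)] -/
theorem isClosedMap_map (f : X ⟶ S) [UniversallyClosed f.left] [QuasiCompact f.left] :
    IsClosedMap (map f : AlgPoints X L → AlgPoints S L) :=
  (isProperMap_map f).isClosedMap

/-- Preimages of compact subsets of `S(L)` under `f(L)` are compact, for `f` universally closed
and quasi-compact (e.g. proper): tubes over compact base sets are compact.
[cite: SGA1, Exp. XII Prop. 3.2 (v)] -/
theorem isCompact_preimage_map (f : X ⟶ S) [UniversallyClosed f.left] [QuasiCompact f.left]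
    {C : Set (AlgPoints S L)} (hC : IsCompact C) : IsCompact (map f ⁻¹' C) :=
  (isProperMap_map f).isCompact_preimage hC

/-- **Tube lemma for proper families.** For `f` universally closed and quasi-compact (e.g.
proper), every open `W ⊆ X(L)` containing the fibre `f(L)⁻¹{t}` contains a whole tube:
there is an open `V ∋ t` with `f(L)⁻¹ V ⊆ W` (take `V := S(L) ∖ f(X(L) ∖ W)`, open since `f(L)`
is closed). [cite: SGA1, Exp. XII Prop. 3.2 (v)] -/
theorem exists_isOpen_preimage_map_subset (f : X ⟶ S) [UniversallyClosed f.left]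
    [QuasiCompact f.left] (t : AlgPoints S L) {W : Set (AlgPoints X L)} (hW : IsOpen W)
    (htW : map f ⁻¹' {t} ⊆ W) :
    ∃ V : Set (AlgPoints S L), IsOpen V ∧ t ∈ V ∧ map f ⁻¹' V ⊆ W := by
  refine ⟨(map f '' Wᶜ)ᶜ, (isClosedMap_map f _ hW.isClosed_compl).isOpen_compl, ?_, ?_⟩
  · rintro ⟨P, hP, hPt⟩
    exact hP (htW hPt)
  · intro P hP
    by_contra hPW
    exact hP ⟨P, hPW, rfl⟩

/-- Tube lemma, neighbourhood form: if `W` is a neighbourhood of the fibre `f(L)⁻¹{t}` (in the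
sense of `𝓝ˢ`) then `f(L)⁻¹ V ⊆ W` for some open `V ∋ t`; i.e. the tubes `f(L)⁻¹ V`, `V ∋ t` open,
are cofinal among the neighbourhoods of the fibre. [cite: SGA1, Exp. XII Prop. 3.2 (v)] -/
theorem exists_isOpen_preimage_map_subset_of_mem_nhdsSet (f : X ⟶ S) [UniversallyClosed f.left]
    [QuasiCompact f.left] (t : AlgPoints S L) {W : Set (AlgPoints X L)}
    (hW : W ∈ 𝓝ˢ (map f ⁻¹' {t})) :
    ∃ V : Set (AlgPoints S L), IsOpen V ∧ t ∈ V ∧ map f ⁻¹' V ⊆ W := by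
  obtain ⟨W', hW'o, htW', hW'W⟩ := mem_nhdsSet_iff_exists.mp hW
  obtain ⟨V, hVo, htV, hV⟩ := exists_isOpen_preimage_map_subset f t hW'o htW'
  exact ⟨V, hVo, htV, hV.trans hW'W⟩

end Main

end AlgPoints

end Literature.AlgebraicGeometry.Motives

end
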